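import Summits.ResolutionOfSingularities.ResolutionOfSingularities.Theorems.UniversalCellsCampaignW82RegularTwistCriterion
import Summits.ResolutionOfSingularities.ResolutionOfSingularities.Theorems.UniversalCellsCampaignW82FrobeniusTwistGraded
import HarnessLib

/-!
# [OURS · L1 W8.2] The W8.2 residual in REGULARITY-ONLY form: «some Frobenius twist of `X₀` has a resolution whose
# NEXT twist is still regular» — the normal form `FrobeniusTwistStepAt` rewritten by the regular-twist criterion

Cell `res-hironaka` (run/shared/lean/pub/res-hironaka/), LADDER-RESOLUTION rung L (RESCUE), slot W8.2; host route
`UniversalCells`, host item `PrimeFieldToPerfect` (stmt-ResolutionOfSingularities-15233), door 1. Links leaf over the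
Theses-free OURS statement file `…FrobeniusTwistGraded.lean` (p483512/v2; `HasSmoothFrobeniusTwistModel`,
`FrobeniusTwistStepAt`) and the proofs file `…RegularTwistCriterion.lean`, written by res-L1-s82-pv-1 (gen 5).

* `hasSmoothFrobeniusTwistModel_iff_regularTwist` — over `K = M(t)`, `M` perfect, for `f₀ : X₀ ⟶ Spec K` separated of
  finite type: «SOME FROBENIUS TWIST `X₀^{(p^e)}` HAS A SMOOTH PROPER BIRATIONAL MODEL» iff «some twist `X₀^{(p^e)}`
  has a proper birational model `Y` whose Frobenius twist `Y^{(p)}` is REGULAR» (`smooth_iff_isRegular_frobeniusTwist`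
  applied to `Y ⟶ X₀^{(p^e)} ⟶ Spec K`). Since `Y^{(p)} ⟶ X₀^{(p^{e+1})}` is again proper birational, this says: the
  hypothesis `Res(M(t))` of the residual supplies regular models of EVERY twist; what is asked is a level `e` and a
  CHOICE of regular model of `X₀^{(p^e)}` whose own twist — a model of `X₀^{(p^{e+1})}` — is regular too.
* `frobeniusTwistStepAt_iff_regularTwistStep` — the same inserted in the slot's door-1 normal form
  `CampaignW82.FrobeniusTwistStepAt p M n` (hence, through `residual_normalForms_tfae` /
  `perfectionStepDimLe_iff_frobeniusTwistStepDimLe`, in `PerfectionStepAt` / `PerfectionStepDimLe`, the registered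
  W8.2 residual): a by-name restatement with NO smoothness predicate left — only `Scheme.IsRegular` of schemes of finite
  type over `M(t)`.

HONEST FRAMING. OURS theorems about OURS statements (role replaced: §17 ¶2 p.89 l.59–62 of [Hironaka2017], typed AS
PRINTED as `S17Methodology.U89_3`); NOT statements of the manuscript; nothing attributed to its author. A normal form
(Cruxes/PrimeFieldToPerfect/KERNEL.md §2 (E3) made a kernel statement), not progress on the open residual. AI work,
weaker than expert review; no claim beyond the kernel.
-/

noncomputable section

set_option linter.dupNamespace false -- mandated namespace of this single-conjunct summit

open CategoryTheory CategoryTheory.Limits AlgebraicGeometry TopologicalSpace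
open Literature.AlgebraicGeometry.Resolution

namespace Summit.ResolutionOfSingularities.ResolutionOfSingularities.Theorems.CampaignW82

/-- **A smooth twisted model is a regular model with regular next twist.** Over `K = RatFunc M`, `M` perfect of
characteristic `p`, for `f₀ : X₀ ⟶ Spec K` separated of finite type: `HasSmoothFrobeniusTwistModel p K f₀` iff there
are `e`, a scheme `Y` and a proper birational `π : Y ⟶ X₀^{(p^e)}` such that the Frobenius twist of `Y` (over `K`
through `π` and the projection) is REGULAR. [cite: EGAIV2, Prop. 6.7.4] -/
theorem hasSmoothFrobeniusTwistModel_iff_regularTwist (p : ℕ) [Fact p.Prime] (M : Type) [Field M] [CharP M p]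
    [PerfectField M] {X₀ : Scheme.{0}} (f₀ : X₀ ⟶ Spec (.of (RatFunc M))) [IsSeparated f₀]
    [LocallyOfFiniteType f₀] [QuasiCompact f₀] :
    HasSmoothFrobeniusTwistModel p (RatFunc M) f₀ ↔
      ∃ (e : ℕ) (Y : Scheme.{0})
        (π : Y ⟶ pullback f₀ (Spec.map (CommRingCat.ofHom (iterateFrobenius (RatFunc M) p e)))),
        IsProper π ∧ IsBirational π ∧
          Scheme.IsRegular (pullback
            (π ≫ pullback.snd f₀ (Spec.map (CommRingCat.ofHom (iterateFrobenius (RatFunc M) p e))))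
            (Spec.map (CommRingCat.ofHom (frobenius (RatFunc M) p)))) := by
  constructor
  · rintro ⟨e, Y, π, hπ, hbir, hsm⟩
    haveI := hπ
    exact ⟨e, Y, π, hπ, hbir, (smooth_iff_isRegular_frobeniusTwist M
      (π ≫ pullback.snd f₀ (Spec.map (CommRingCat.ofHom (iterateFrobenius (RatFunc M) p e))))).mp hsm⟩
  · rintro ⟨e, Y, π, hπ, hbir, hreg⟩
    haveI := hπ
    exact ⟨e, Y, π, hπ, hbir, (smooth_iff_isRegular_frobeniusTwist M
      (π ≫ pullback.snd f₀ (Spec.map (CommRingCat.ofHom (iterateFrobenius (RatFunc M) p e))))).mpr hreg⟩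

/-- **Equivalently, with the model itself a RESOLUTION**: the regular twist `Y^{(p)} → Y` is flat and surjective, so
`Y` is regular too; hence «some twist `X₀^{(p^e)}` has a RESOLUTION `Y` (proper birational, `Y` regular) whose next
twist `Y^{(p)}` is regular as well» — two consecutive regular twists. [cite: EGAIV2, Prop. 6.7.4] -/
theorem hasSmoothFrobeniusTwistModel_iff_regularPair (p : ℕ) [Fact p.Prime] (M : Type) [Field M] [CharP M p]
    [PerfectField M] {X₀ : Scheme.{0}} (f₀ : X₀ ⟶ Spec (.of (RatFunc M))) [IsSeparated f₀]
    [LocallyOfFiniteType f₀] [QuasiCompact f₀] :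
    HasSmoothFrobeniusTwistModel p (RatFunc M) f₀ ↔
      ∃ (e : ℕ) (Y : Scheme.{0})
        (π : Y ⟶ pullback f₀ (Spec.map (CommRingCat.ofHom (iterateFrobenius (RatFunc M) p e)))),
        IsProper π ∧ IsBirational π ∧ Scheme.IsRegular Y ∧
          Scheme.IsRegular (pullback
            (π ≫ pullback.snd f₀ (Spec.map (CommRingCat.ofHom (iterateFrobenius (RatFunc M) p e))))
            (Spec.map (CommRingCat.ofHom (frobenius (RatFunc M) p)))) := by
  rw [hasSmoothFrobeniusTwistModel_iff_regularTwist]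
  constructor
  · rintro ⟨e, Y, π, hπ, hbir, hreg⟩
    haveI := hπ
    refine ⟨e, Y, π, hπ, hbir, ?_, hreg⟩
    -- `Y^{(p)} → Y` is flat and surjective (base change of `Spec Frob_K`), so regularity descends to `Y`
    let g := π ≫ pullback.snd f₀ (Spec.map (CommRingCat.ofHom (iterateFrobenius (RatFunc M) p e)))
    haveI : IsNoetherian Y := Scheme.isNoetherian_of_finiteType_over_field g
    haveI : Surjective (Spec.map (CommRingCat.ofHom (frobenius (RatFunc M) p))) :=
      Literature.AlgebraicGeometry.Resolution.DeJong1996.Stage.surjective_specMap _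
    haveI : Flat (Spec.map (CommRingCat.ofHom (frobenius (RatFunc M) p))) :=
      Literature.AlgebraicGeometry.Resolution.DeJong1996.Stage.flat_specMap _
    exact Literature.AlgebraicGeometry.Resolution.DeJong1996.Stage.isRegular_of_flat_surjective
      (pullback.fst g (Spec.map (CommRingCat.ofHom (frobenius (RatFunc M) p)))) hreg
  · rintro ⟨e, Y, π, hπ, hbir, -, hreg⟩
    exact ⟨e, Y, π, hπ, hbir, hreg⟩

/-- **THE DOOR-1 RESIDUAL IN REGULARITY-ONLY FORM.** For a PERFECT constant field `M` of characteristic `p` and a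
grade `n`, the slot's normal form `FrobeniusTwistStepAt p M n` (≡ `PerfectionStepAt M n` ≡ `SmoothTwistStepAt M n`,
`residual_normalForms_tfae`) is EQUIVALENT to: if every integral separated scheme of finite type of dimension `≤ n`
over `M(t)` has a resolution, then for every separated `f₀ : X₀ ⟶ Spec M(t)` of finite type with
`topologicalKrullDim X₀ ≤ n` which is integral over the perfect closure there are `e` and a proper birational model
`Y ⟶ X₀^{(p^e)}` whose Frobenius twist `Y^{(p)}` is regular. [cite: EGAIV2, Prop. 6.7.4] -/
theorem frobeniusTwistStepAt_iff_regularTwistStep (p : ℕ) [Fact p.Prime] (M : Type) [Field M] [CharP M p]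
    [PerfectField M] (n : WithBot ℕ∞) :
    FrobeniusTwistStepAt p M n ↔
      ((∀ (X : Scheme.{0}) (f : X ⟶ Spec (.of (RatFunc M))),
          IsSeparated f → LocallyOfFiniteType f → QuasiCompact f → IsIntegral X →
            topologicalKrullDim X ≤ n → Scheme.HasResolution X) →
        ∀ (X₀ : Scheme.{0}) (f₀ : X₀ ⟶ Spec (.of (RatFunc M))),
          IsSeparated f₀ → LocallyOfFiniteType f₀ → QuasiCompact f₀ → topologicalKrullDim X₀ ≤ n →
            IntegralOverPerfectClosure (RatFunc M) f₀ →
              ∃ (e : ℕ) (Y : Scheme.{0})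
                (π : Y ⟶ pullback f₀ (Spec.map (CommRingCat.ofHom (iterateFrobenius (RatFunc M) p e)))),
                IsProper π ∧ IsBirational π ∧
                  Scheme.IsRegular (pullback
                    (π ≫ pullback.snd f₀ (Spec.map (CommRingCat.ofHom (iterateFrobenius (RatFunc M) p e))))
                    (Spec.map (CommRingCat.ofHom (frobenius (RatFunc M) p))))) := by
  refine forall_congr' fun _ => forall_congr' fun X₀ => forall_congr' fun f₀ => ?_
  refine forall_congr' fun hs => forall_congr' fun hl => forall_congr' fun hq => forall_congr' fun _ =>
    forall_congr' fun _ => ?_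
  haveI := hs; haveI := hl; haveI := hq
  exact hasSmoothFrobeniusTwistModel_iff_regularTwist p M f₀

end Summit.ResolutionOfSingularities.ResolutionOfSingularities.Theorems.CampaignW82

end
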